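import Summits.BirchSwinnertonDyer.BirchSwinnertonDyer.Theorems.EisensteinDepletionAtTwoStarOptBNSFNsfDoorPrint
import Summits.BirchSwinnertonDyer.BirchSwinnertonDyer.Theorems.EisensteinDepletionAtTwoStarOptBSFStevensAllLevels
import HarnessLib

/-!
# Line `star` on crux E1M (stmt-BirchSwinnertonDyer-20341), squarefree residue `stub_starOptBSF`: THE ODD-SHIMURA-INDEX HALF FROM PRINT

Lead star-p1 GEN 15.  `StarOptB` (aside item 24445: the `X₀(N)`-lattice-optimal curve `W₀` of a habitat class carries a rational
2-torsion point that is ODD and NOT ramified at 2) splits along the parity of the SHIMURA INDEX of the class's newform `f`, i.e. the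
exponent of `Λ_f / Λ₁(f)` (`Λ₁(f) = periodLatticeGamma1 f ≤ Λ_f = periodLattice f`; `[Λ_f : Λ₁(f)]` = degree of the Shimura cover
`E₀ → E₁` up to the Manin constants):

* ODD index (`∃ d` odd, `dΛ_f ⊆ Λ₁(f)`) — THIS FILE, from the three prints of line `nsf` and NOTHING ELSE, AT EVERY LEVEL (no
  squarefree / non-squarefree / `N ≠ 15` hypothesis): «Stevens at 2» for the `X₁(N)`-type curve `W₁` at every level
  (`StevensAllLevels.stevensAtTwoX1Int_allLevels`, UBD) ∘ the odd-degree isogeny `W₀ → W₁` of the rational lattice inclusion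
  `(dc₁/q)Λ_{W₀} ⊆ Λ_{W₁}` (`exists_isogeny_odd_degree_of_oddIndex`) ∘ odd transport of formal 2-torsion
  (`OddTransportRamified.not_exists_ramified_of_isogeny_of_odd`) ∘ regime transport (`NsfReduction.regimeTransport`).
  The non-squarefree door is the special case `d = p` a traceless prime (Ling–Oesterlé, `pMulLatticeLeGamma1OfTracelessPrime_holds`).
* EVEN index — the research residue of E1M after this GEN (`stub_starOptBSFEven` of Lines/star.lean v7): numerically (Cremona
  `allisog`, odd squarefree `N < 5·10⁵`, `N ≠ 15`) it occurs in 27 of 20 577 habitat classes, always with `W₀` the full-2-torsion centre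
  of the 2-isogeny tree whose formal point is not its odd point (folder numerics/sf_census.out); at prime level it is the
  Neumann–Setzer / `X₀(17)` phenomenon (90 classes, all MID, no habitat curve).

CONDITIONAL on the prints named in each signature; no `sorry`, no new definition; nothing here reads `r_an`; StarOptB / E1M / BSD
are NOT proved by this file.
-/

set_option linter.dupNamespace false
set_option autoImplicit false

noncomputable section

open scoped Classical
open Literature.NumberTheory.EllipticCurves Literature.NumberTheory.EllipticCurves.Greenberg1999
open Literature.NumberTheory.EllipticCurves.ModularForms
open Summit.BirchSwinnertonDyer.BirchSwinnertonDyer.Theorems.DepletionAtTwo.OddTransportRamified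

namespace Summit.BirchSwinnertonDyer.BirchSwinnertonDyer.Theorems.DepletionAtTwo.SfOddCover

/-! ### A finite quotient killed by an odd number has odd order -/

/-- **Cauchy.** If `A, B` are additive subgroups of a commutative group with `d • b ∈ A` for all `b ∈ B`, `d` odd, and
`[B : A ∩ B]` finite (non-zero), then `[B : A ∩ B]` is odd: an element of order `2` of the quotient would have order dividing `d`.
(`ShimuraCover.odd_relIndex_of_forall_nsmul_mem` is the case `d` an odd prime.) [folklore] -/
theorem odd_relIndex_of_forall_odd_nsmul_mem {G : Type*} [AddCommGroup G] (A B : AddSubgroup G) {d : ℕ}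
    (hd : Odd d) (hdB : ∀ b ∈ B, d • b ∈ A) (hfin : A.relIndex B ≠ 0) :
    Odd (A.relIndex B) := by
  rw [AddSubgroup.relIndex] at hfin ⊢
  set H : AddSubgroup B := A.addSubgroupOf B with hH
  haveI : Finite (B ⧸ H) := Nat.finite_of_card_ne_zero (by rwa [← AddSubgroup.index] )
  rw [← Nat.not_even_iff_odd]
  intro heven
  have h2 : 2 ∣ Nat.card (B ⧸ H) := by
    rw [← AddSubgroup.index]; exact even_iff_two_dvd.mp heven
  haveI : Fact (Nat.Prime 2) := ⟨Nat.prime_two⟩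
  obtain ⟨x, hx⟩ := exists_prime_addOrderOf_dvd_card' (G := B ⧸ H) 2 h2
  -- every element of the quotient is killed by `d`
  have hkill : d • x = 0 := by
    obtain ⟨b, rfl⟩ := QuotientAddGroup.mk_surjective x
    rw [← QuotientAddGroup.mk_nsmul, QuotientAddGroup.eq_zero_iff, hH, AddSubgroup.mem_addSubgroupOf,
      AddSubgroup.coe_nsmul]
    exact hdB b b.2
  have hdvd : addOrderOf x ∣ d := addOrderOf_dvd_of_nsmul_eq_zero hkill
  rw [hx] at hdvd
  exact (Nat.not_even_iff_odd.mpr hd) (even_iff_two_dvd.mpr hdvd)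

/-! ### The odd Shimura cover from an odd index -/

/-- **An odd Shimura index gives an odd-degree isogeny `W₀ → W₁`.**  Let `f ∈ S₂(Γ₀(N))` with an ODD `d` such that `dΛ_f ⊆ Λ₁(f)`
(`Λ₁(f) ≤ Λ_f` always, `periodLatticeGamma1_le_periodLattice`); `W₀/ℚ` elliptic with a Néron period pair `L₀` spanning `qΛ_f`
(`q ∈ ℚˣ`, the `X₀(N)`-lattice clause) and `W₁/ℚ` elliptic with a Néron period pair `L₁` spanning `c₁Λ₁(f)` (`c₁ ∈ ℚˣ`, Stevens'
`X₁(N)`-lattice clause).  Then there is a `ℚ`-isogeny `W₀ → W₁` of ODD degree: the isogeny of the rational lattice inclusion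
`(dc₁/q)Λ₀ = dc₁Λ_f ⊆ c₁Λ₁(f) = Λ₁` (`exists_isogeny_degree_eq_of_isNeronLatticeOf`) has degree `[(q/dc₁)Λ₁ : Λ₀]`, a quotient killed
by `d`.  `ShimuraCover.exists_isogeny_odd_degree_of_periodLattices` is the case `d = p` a traceless prime.
[cite: SilvermanAEC2009, Thm. VI.4.1(b)] [cite: Stevens1989, §2] -/
theorem exists_isogeny_odd_degree_of_oddIndex (W₀ W₁ : WeierstrassCurve ℚ) [W₀.IsElliptic] [W₁.IsElliptic]
    {N : ℕ} [NeZero N] (f : CuspForm (CongruenceSubgroup.Gamma0 N) 2)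
    (hodd : ∃ d : ℕ, Odd d ∧ ∀ w ∈ periodLattice f, (d : ℂ) * w ∈ periodLatticeGamma1 f)
    {L₀ L₁ : PeriodPair} (hL₀ : IsNeronLatticeOf (W₀.baseChange ℂ) L₀)
    (hL₁ : IsNeronLatticeOf (W₁.baseChange ℂ) L₁) {q c₁ : ℚ} (hq : q ≠ 0) (hc₁ : c₁ ≠ 0)
    (hin₀ : ∀ w ∈ periodLattice f, (q : ℂ) * w ∈ L₀.lattice)
    (hout₀ : ∀ z ∈ L₀.lattice, ∃ w ∈ periodLattice f, z = (q : ℂ) * w)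
    (hin₁ : ∀ w ∈ periodLatticeGamma1 f, (c₁ : ℂ) * w ∈ L₁.lattice)
    (hout₁ : ∀ z ∈ L₁.lattice, ∃ w ∈ periodLatticeGamma1 f, z = (c₁ : ℂ) * w) :
    ∃ φ : WeierstrassCurve.Isogeny W₀ W₁, Odd φ.degree := by
  obtain ⟨d, hd, hdΛ⟩ := hodd
  have hd0 : d ≠ 0 := (Odd.pos hd).ne'
  have hdQ : (d : ℚ) ≠ 0 := by exact_mod_cast hd0
  set c : ℚ := d * c₁ / q with hc
  have hc0 : c ≠ 0 := div_ne_zero (mul_ne_zero hdQ hc₁) hq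
  have hcC : (c : ℂ) = (d : ℂ) * (c₁ : ℂ) / (q : ℂ) := by rw [hc]; push_cast; ring
  have hqC : (q : ℂ) ≠ 0 := by exact_mod_cast hq
  -- the rational lattice inclusion `c Λ₀ ⊆ Λ₁`
  have hle : ∀ z ∈ L₀.lattice, (c : ℂ) * z ∈ L₁.lattice := by
    intro z hz
    obtain ⟨w, hw, rfl⟩ := hout₀ z hz
    have h1 : (c : ℂ) * ((q : ℂ) * w) = (c₁ : ℂ) * ((d : ℂ) * w) := by
      rw [hcC]; field_simp
    rw [h1]
    exact hin₁ _ (hdΛ w hw)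
  obtain ⟨φ, hdeg⟩ := exists_isogeny_degree_eq_of_isNeronLatticeOf W₀ W₁ hL₀ hL₁ hc0 hle
  refine ⟨φ, ?_⟩
  rw [hdeg]
  -- the quotient `c⁻¹Λ₁ / Λ₀` is killed by `d`
  refine odd_relIndex_of_forall_odd_nsmul_mem _ _ hd (fun b hb ↦ ?_) (by rw [← hdeg]; exact φ.degree_pos.ne')
  rw [AddSubgroup.mem_comap, AddMonoidHom.coe_mulLeft, Submodule.mem_toAddSubgroup] at hb
  obtain ⟨w, hw, hbw⟩ := hout₁ _ hb
  have hwf : w ∈ periodLattice f := periodLatticeGamma1_le_periodLattice f hw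
  have hb' : (d : ℂ) * b = (q : ℂ) * w := by
    rw [hcC] at hbw
    have hdC : (d : ℂ) ≠ 0 := by exact_mod_cast hd0
    have hc₁C : (c₁ : ℂ) ≠ 0 := by exact_mod_cast hc₁
    field_simp at hbw
    linear_combination hbw
  rw [Submodule.mem_toAddSubgroup, nsmul_eq_mul, hb']
  exact hin₀ w hwf

/-- **Transport along the odd cover.**  Globally minimal elliptic `W₀, W₁/ℚ`, `W₀` good ordinary at `2`, `f` with an odd Shimura index,
Néron lattices `qΛ_f` and `c₁Λ₁(f)`: if `W₁` has no formal rational 2-torsion point then neither has `W₀`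
(`exists_isogeny_odd_degree_of_oddIndex` + `OddTransportRamified.not_exists_ramified_of_isogeny_of_odd`).
[cite: Stevens1989, §2] [cite: GreenbergLNM1716, §5 p. 168] -/
theorem not_exists_ramified_of_oddIndex (W₀ W₁ : WeierstrassCurve ℚ) [W₀.IsElliptic] [W₀.IsGloballyMinimal]
    [W₁.IsElliptic] [W₁.IsGloballyMinimal] (hord : IsOrdinaryAt W₀ 2)
    {N : ℕ} [NeZero N] (f : CuspForm (CongruenceSubgroup.Gamma0 N) 2)
    (hodd : ∃ d : ℕ, Odd d ∧ ∀ w ∈ periodLattice f, (d : ℂ) * w ∈ periodLatticeGamma1 f)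
    {L₀ L₁ : PeriodPair} (hL₀ : IsNeronLatticeOf (W₀.baseChange ℂ) L₀)
    (hL₁ : IsNeronLatticeOf (W₁.baseChange ℂ) L₁) {q c₁ : ℚ} (hq : q ≠ 0) (hc₁ : c₁ ≠ 0)
    (hin₀ : ∀ w ∈ periodLattice f, (q : ℂ) * w ∈ L₀.lattice)
    (hout₀ : ∀ z ∈ L₀.lattice, ∃ w ∈ periodLattice f, z = (q : ℂ) * w)
    (hin₁ : ∀ w ∈ periodLatticeGamma1 f, (c₁ : ℂ) * w ∈ L₁.lattice)
    (hout₁ : ∀ z ∈ L₁.lattice, ∃ w ∈ periodLatticeGamma1 f, z = (c₁ : ℂ) * w)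
    (hno₁ : ¬ ∃ x₁ : ℚ, HasRationalTwoTorsionX W₁ x₁ ∧ TwoTorsionRamifiedAtTwo x₁) :
    ¬ ∃ x₀ : ℚ, HasRationalTwoTorsionX W₀ x₀ ∧ TwoTorsionRamifiedAtTwo x₀ := by
  obtain ⟨φ, hφ⟩ := exists_isogeny_odd_degree_of_oddIndex W₀ W₁ f hodd hL₀ hL₁ hq hc₁ hin₀ hout₀ hin₁ hout₁
  exact not_exists_ramified_of_isogeny_of_odd φ hφ hord hno₁

/-- **P-E₀ at ODD Shimura index, every level, modulo print.**  The `X₀(N)`-lattice-optimal globally minimal `W₀` (Néron lattice `qΛ_f`)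
of a class whose newform `f` has an odd `d` with `dΛ_f ⊆ Λ₁(f)`, good ordinary at `2`, has no FORMAL rational 2-torsion point —
«Stevens at 2» for the `X₁(N)`-type curve at every level (`StevensAllLevels.stevensAtTwoX1Int_allLevels`, UBD) transported along the odd
cover; the `X₁(N)`-type curve with INTEGER Manin constant comes from Modularity + the CES/Stevens datum (`NsfDoorPrint.x1OptimalInt_of_print`).
Generalises `NsfDoorPrint.pE0_ord` (there `d = p` is a traceless prime). CONDITIONAL on the three prints.
[cite: Stevens1989, §2] [cite: ConradEdixhovenStein2003, §6.1 Lemma 6.1.6] [cite: CalegariDimitrovTang2025, Thm. 1.0.1] -/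
theorem pE0_of_oddIndex (hU : Literature.NumberTheory.Automorphic.CalegariDimitrovTang2025_unboundedDenominators)
    (hnf : exists_isNewformOf) (hex : exists_optimal_gamma1ParametrizationData) :
    ∀ (W₀ : WeierstrassCurve ℚ) [W₀.IsElliptic] [W₀.IsGloballyMinimal]
      ⦃N : ℕ⦄ [NeZero N] (f : CuspForm (CongruenceSubgroup.Gamma0 N) 2), IsNewformOf W₀ f →
      (∃ d : ℕ, Odd d ∧ ∀ w ∈ periodLattice f, (d : ℂ) * w ∈ periodLatticeGamma1 f) → IsOrdinaryAt W₀ 2 →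
      ∀ (L₀ : PeriodPair), IsNeronLatticeOf (W₀.baseChange ℂ) L₀ →
      ∀ (q : ℚ), q ≠ 0 → (∀ z ∈ periodLattice f, (q : ℂ) * z ∈ L₀.lattice) →
      (∀ z ∈ L₀.lattice, ∃ w ∈ periodLattice f, z = (q : ℂ) * w) →
      ∀ (x₀ : ℚ), HasRationalTwoTorsionX W₀ x₀ → ¬ TwoTorsionRamifiedAtTwo x₀ := by
  intro W₀ _ _ N _ f hW₀ hodd hord₀ L₀ hL₀ q hq hin hout x₀ hx₀ hram
  have hS := StevensAllLevels.stevensAtTwoX1Int_allLevels hU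
  -- Stevens' `X₁(N)`-type curve of the class, with its INTEGER Manin constant
  obtain ⟨W₁, _i₁, _i₂, L₁, c₁, hW₁, hL₁, hc₁, hint, hin₁, hout₁⟩ := NsfDoorPrint.x1OptimalInt_of_print hnf hex W₀ f hW₀
  -- Stevens at 2 for `W₁`, at this level
  have hno₁ : ¬ ∃ x₁ : ℚ, HasRationalTwoTorsionX W₁ x₁ ∧ TwoTorsionRamifiedAtTwo x₁ := by
    rintro ⟨x₁, hx₁, hram₁⟩
    exact hS W₁ f hW₁ L₁ hL₁ c₁ hc₁ hin₁ hout₁ hint x₁ hx₁ hram₁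
  -- the odd cover transports it to `W₀`
  exact not_exists_ramified_of_oddIndex W₀ W₁ hord₀ f hodd hL₀ hL₁ hq hc₁ hin hout hin₁ hout₁ hno₁ ⟨x₀, hx₀, hram⟩

/-- **THE ODD-INDEX HALF OF `StarOptB`, FROM PRINT, AT EVERY LEVEL.**  For `W` globally minimal, good ordinary at `2`, with a unique
rational 2-torsion point of Greenberg type A xor B, a newform `f` of `W` WITH AN ODD SHIMURA INDEX (`∃ d` odd, `dΛ_f ⊆ Λ₁(f)`), and the
curve `W₀` of the class with Néron lattice `qΛ_f`: `W₀` has a rational 2-torsion point that is ODD and NOT ramified at `2`.  No level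
hypothesis (`N ≠ 15`, squarefree or not) is needed: `pE0_of_oddIndex` + regime transport (`NsfReduction.regimeTransport`) + Faltings
(`IsNewformOf.isIsogenous`).  This is `StarOptB` (item 24445) ∧ `stub_starOptBSF` (line `star` v6) on the odd-index locus; with
Ling–Oesterlé's `pΛ_f ⊆ Λ₁(f)` at a traceless prime it contains the whole non-squarefree door `NsfDoorPrint.starOptBNSF_of_print`.
CONDITIONAL on Modularity, the CES/Stevens `Γ₁(N)`-datum and UBD; does not close any item by itself.
[cite: Stevens1989, §2] [cite: CalegariDimitrovTang2025, Thm. 1.0.1] [cite: BCDTJAMS2001, Thm. A] [cite: GreenbergLNM1716, Prop. 5.14] -/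
theorem starOptB_oddIndex_of_print (hnf : exists_isNewformOf) (hex : exists_optimal_gamma1ParametrizationData)
    (hU : Literature.NumberTheory.Automorphic.CalegariDimitrovTang2025_unboundedDenominators) :
    ∀ (W : WeierstrassCurve ℚ) [W.IsElliptic] [W.IsGloballyMinimal] (x : ℚ), IsOrdinaryAt W 2 →
      HasUniqueRationalTwoTorsionX W x →
      ((TwoTorsionRamifiedAtTwo x ∧ ¬ TwoTorsionOdd W x) ∨ (TwoTorsionOdd W x ∧ ¬ TwoTorsionRamifiedAtTwo x)) →
      ∀ ⦃N : ℕ⦄ [NeZero N] (f : CuspForm (CongruenceSubgroup.Gamma0 N) 2), IsNewformOf W f →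
      (∃ d : ℕ, Odd d ∧ ∀ w ∈ periodLattice f, (d : ℂ) * w ∈ periodLatticeGamma1 f) →
      ∀ (W₀ : WeierstrassCurve ℚ) [W₀.IsElliptic] [W₀.IsGloballyMinimal], IsNewformOf W₀ f →
      ∀ (L₀ : PeriodPair), IsNeronLatticeOf (W₀.baseChange ℂ) L₀ → ∀ (q : ℚ), q ≠ 0 →
      (∀ z ∈ periodLattice f, (q : ℂ) * z ∈ L₀.lattice) → (∀ z ∈ L₀.lattice, ∃ w ∈ periodLattice f, z = (q : ℂ) * w) →
      ∃ x₀ : ℚ, HasRationalTwoTorsionX W₀ x₀ ∧ TwoTorsionOdd W₀ x₀ ∧ ¬ TwoTorsionRamifiedAtTwo x₀ := by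
  intro W _ _ x hord hux htype N _ f hW hodd W₀ _ _ hW₀ L₀ hL₀ q hq hin hout
  have hiso : WeierstrassCurve.IsIsogenous W W₀ :=
    IsNewformOf.isIsogenous WeierstrassCurve.isIsogenous_iff_frobeniusTrace_eq_holds hW hW₀
  have hord₀ : IsOrdinaryAt W₀ 2 :=
    Summit.BirchSwinnertonDyer.BirchSwinnertonDyer.Theorems.IsogenyMuShift.isOrdinaryAt_of_isIsogenous hiso hord
  refine NsfReduction.regimeTransport W x hord hux htype W₀ hiso ?_
  rintro ⟨x₀, hx₀, hram⟩
  exact pE0_of_oddIndex hU hnf hex W₀ f hW₀ hodd hord₀ L₀ hL₀ q hq hin hout x₀ hx₀ hram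

/-- **The non-squarefree door is an instance**: at a level with a traceless prime `p ∣ N`, `p ≠ 2` (`a_p(f) = 0`), the Shimura index is
odd with witness `d = p` (Ling–Oesterlé `U_p = p` on `Σ(N)`: `pΛ_f ⊆ Λ₁(f)`, tree `pMulLatticeLeGamma1OfTracelessPrime_holds`).
[cite: LingOesterle1991, Thm. 6] -/
theorem oddIndex_of_tracelessPrime {N : ℕ} [NeZero N] (f : CuspForm (CongruenceSubgroup.Gamma0 N) 2) (hf : IsNewform0 f)
    {p : ℕ} (hp : p.Prime) (hp2 : p ≠ 2) (hpN : p ∣ N) (hap : cuspCoeff f p = 0) :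
    ∃ d : ℕ, Odd d ∧ ∀ w ∈ periodLattice f, (d : ℂ) * w ∈ periodLatticeGamma1 f :=
  ⟨p, hp.odd_of_ne_two hp2, pMulLatticeLeGamma1OfTracelessPrime_holds N f hf p hp hpN hap⟩

end Summit.BirchSwinnertonDyer.BirchSwinnertonDyer.Theorems.DepletionAtTwo.SfOddCover

end
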